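import Summits.FinalStateConjecture.FinalStateConjecture.Theorems.SwallowTheDatumSubdataDevelopmentsEmbedHcauchy
import Summits.FinalStateConjecture.FinalStateConjecture.Theorems.SwallowTheDatumSubdataDevelopmentsEmbedNCBImage
import Literature.Geometry.Lorentzian.InitialDataPullback

/-!
# Route SwallowTheDatum · item `SubdataDevelopmentsEmbed` (stmt-FinalStateConjecture-10053) —
# towards `hncb`, II: the globally hyperbolic region of the sub-datum receives every relative
# common sub-development

`hcauchy_holds` (`…Hcauchy.lean`) produces an open connected `V ⊆ M` containing `ι(Φ N)` in
which `ι(Φ N)` is a Cauchy hypersurface — the connected component of `ι(Φ N)` in the interior of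
its domain of dependence. This file records the UNIVERSAL PROPERTY of that region (the
universality clause of `exists_opens_isCauchyHypersurface_of_localDoD'`, `…DoDAssembly.lean`)
in the form the reduction of `hncb` to same-data statements needs: the image `ψ(U)` of every
relative common sub-development `(U, ψ)` of a Cauchy development `𝒟'` of the sub-data into `𝒟`
over `Φ` (injective on `U`) lies in `V` — it is open (`ψ|_U` is a local diffeomorphism),
connected, meets `ι(Φ N)`, and lies in the domain of dependence of `ι(Φ N)`
(`forall_endless_meets_of_relCGHD`, `…NCBImage.lean`). Consequently every relative common
sub-development factors through the domain-of-dependence development `R ≅ V` of the sub-data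
(`hdod_of_cauchyRegion`), a development of the SAME data as `𝒟'`.

No definition, no named fact.
-/

noncomputable section

open Function Set Filter Topology TopologicalSpace
open scoped Manifold ContDiff Topology

namespace Summit.FinalStateConjecture.FinalStateConjecture.Theorems

namespace SubdataDevelopmentsEmbed

open Literature.Geometry.Lorentzian

/-- **The globally hyperbolic region of the sub-datum and its universal property.** For a vacuum
Cauchy development `𝒟` of data on `X` and an open embedding `Φ : N → X` of a connected manifold:
an open connected `V ⊆ M` containing `ι(Φ N)`, in which `ι(Φ N)` is a Cauchy hypersurface, and
which contains the image `ψ(U)` of every relative common sub-development `(U, ψ)` over `Φ`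
(`U ⊇ ι'(N)` connected, `ψ` injective on `U`) of any Cauchy development `𝒟'` of the pulled-back
data. -/
theorem hcauchy_holds' (X : Type) [TopologicalSpace X] [ChartedSpace E3 X] [IsManifold (𝓡 3) ∞ X]
    [T2Space X] [SecondCountableTopology X] [ConnectedSpace X] (D : InitialDataSet (𝓡 3) X)
    (𝒟 : VacuumCauchyDevelopment D) (N : Type) [TopologicalSpace N] [ChartedSpace E3 N]
    [IsManifold (𝓡 3) ∞ N] [ConnectedSpace N] (Φ : N → X)
    (hΦ : ContMDiff (𝓡 3) (𝓡 3) (∞ + 1) Φ) (hΦ' : ∀ u, Injective (mfderiv (𝓡 3) (𝓡 3) Φ u))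
    (hΦo : IsOpenEmbedding Φ) :
    ∃ V : Opens 𝒟.carrier, IsConnected (V : Set 𝒟.carrier) ∧ (∀ u, 𝒟.embed (Φ u) ∈ V) ∧
      (𝒟.metric.restrict PseudoRiemannianMetric.contMDiff_restrict_holds V).IsCauchyHypersurface
        (𝒟.timeOrientation.restrict PseudoRiemannianMetric.contMDiff_restrict_holds
          𝒟.timeOrientation.contMDiff_restrict_holds V) (Subtype.val ⁻¹' range (𝒟.embed ∘ Φ)) ∧
      ∀ (𝒟' : CauchyDevelopment (D.comap Φ hΦ hΦ')) (U : Opens 𝒟'.carrier)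
        (ψ : 𝒟'.carrier → 𝒟.carrier),
        (∀ u, 𝒟'.embed u ∈ U) → IsConnected (U : Set 𝒟'.carrier) →
        (𝒟'.metric.restrict PseudoRiemannianMetric.contMDiff_restrict_holds
            U).IsCauchyHypersurface
          (𝒟'.timeOrientation.restrict PseudoRiemannianMetric.contMDiff_restrict_holds
            𝒟'.timeOrientation.contMDiff_restrict_holds U) (Subtype.val ⁻¹' range 𝒟'.embed) →
        ContMDiffOn (𝓡 4) (𝓡 4) ∞ ψ U →
        (∀ p ∈ U, pullbackBilin (I := 𝓡 4) (I' := 𝓡 4) ψ 𝒟.metric.val p = 𝒟'.metric.val p) →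
        (∀ p ∈ U, 𝒟.timeOrientation.IsFutureDirected
          (mfderiv (𝓡 4) (𝓡 4) ψ p (𝒟'.timeOrientation.vectorField p))) →
        ψ ∘ 𝒟'.embed = 𝒟.embed ∘ Φ → InjOn ψ U → ψ '' (U : Set 𝒟'.carrier) ⊆ V := by
  haveI : LocallyConnectedSpace 𝒟.carrier :=
    ChartedSpace.locallyConnectedSpace (EuclideanSpace ℝ (Fin (3 + 1))) 𝒟.carrier
  have hn : (2 : ℕ∞ω) ≤ ∞ := WithTop.coe_le_coe.mpr le_top
  have hS : range (𝒟.embed ∘ Φ) = 𝒟.embed '' range Φ := Set.range_comp _ _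
  have hSsub : range (𝒟.embed ∘ Φ) ⊆ range 𝒟.embed := by
    rw [hS]; exact image_subset_range _ _
  have hSc : IsConnected (range (𝒟.embed ∘ Φ)) :=
    isConnected_range (𝒟.isSmoothEmbedding.contMDiff.continuous.comp hΦ.continuous)
  have hL := localDoD_image 𝒟.toCauchyDevelopment hΦo.isOpen_range
  rw [← hS] at hL
  obtain ⟨V, hVc, hSV, hV, huniv⟩ :=
    exists_opens_isCauchyHypersurface_of_localDoD' hn 𝒟.isCauchyHypersurface hSsub hSc hL
  refine ⟨V, hVc, fun u ↦ hSV ⟨u, rfl⟩, hV, fun 𝒟' U ψ hιU hUc hC hs hi ht hc hinj ↦ ?_⟩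
  -- `ψ(U)` is open (local diffeomorphism), connected, meets `ι(Φ N)`, and lies in `D(ι(Φ N))`
  have hd : ∀ y : U, MDifferentiableAt (𝓡 4) (𝓡 4) ψ y.1 := fun y ↦
    ((hs y.1 y.2).contMDiffAt (U.2.mem_nhds y.2)).mdifferentiableAt (by simp)
  have hiso : (𝒟'.metric.restrict PseudoRiemannianMetric.contMDiff_restrict_holds
      U).IsIsometricImmersion 𝒟.metric.toPseudoRiemannianMetric
      (ψ ∘ (Subtype.val : U → 𝒟'.carrier)) := by
    refine ⟨hs.comp_contMDiff contMDiff_subtype_val fun y ↦ y.2, fun y ↦ ?_⟩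
    ext v w
    rw [pullbackBilin_apply, mfderiv_comp_subtypeVal (hd y)]
    have h := congrArg (fun b ↦ b v w) (hi y.1 y.2)
    simp only [pullbackBilin_apply] at h
    exact h
  have hopen : IsOpen (ψ '' (U : Set 𝒟'.carrier)) := by
    rw [← range_restrict]   -- ψ '' U = range (U.restrict ψ) = range (ψ ∘ Subtype.val)
    exact (LorentzianMetric.isLocalDiffeomorph_of_isIsometricImmersion hiso).isOpen_range
  have hconn : IsPreconnected (ψ '' (U : Set 𝒟'.carrier)) :=
    (hUc.image ψ hs.continuousOn).isPreconnected
  obtain ⟨v⟩ : Nonempty N := inferInstance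
  have hmeet : (ψ '' (U : Set 𝒟'.carrier) ∩ range (𝒟.embed ∘ Φ)).Nonempty :=
    ⟨ψ (𝒟'.embed v), ⟨𝒟'.embed v, hιU v, rfl⟩, v, (congrFun hc v).symm⟩
  exact huniv _ hopen hconn hmeet
    (forall_endless_meets_of_relCGHD 𝒟' 𝒟.toCauchyDevelopment U ψ hC hs hi ht hc hinj)

end SubdataDevelopmentsEmbed

end Summit.FinalStateConjecture.FinalStateConjecture.Theorems

end
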